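import Summits.PneNP.PneNP.Theses.DescentTower
import Literature.ModelTheory.FiniteModelTheory.SparseBoundedDegreeFooling

/-!
# Line `sparse_support` — skeleton for piece `JointSublinearFooling` (crux B, stmt-PneNP-2538),
# the second leaf of the split of `ThreeColNotInP` (stmt-PneNP-2536)

Both halves of crux B are PROVED in the tree at linear level, on different families: SOS
(`SOSThreeColLinearLowerBound_holds`, 3-XOR gadget instances — which the ℤ-part rejects) and ℤ
(`connerydGhannanePang2025_thm_6_1_holds`; deterministic core
`graphCohomologicallyKConsistent_of_sparse_of_degree_le`: sparse bounded-degree graphs are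
cohomologically `κ`-consistent at linear `κ`). The line cuts the COUPLING as follows: the open stub asks
for a linear-degree pseudoexpectation whose positively weighted `≤ κ`-sections are EXACTLY the sections
of the greatest self-supporting family `SectionSystem.gfp κ (graphHomSystem κ G K₃)` (Ó Conghaile's
cohomological `κ`-consistency family, tree notion); the ℤ-sections of the inline coupled level then
come for free (`SectionSystem.gfp_isSelfSupporting`, a pure format bridge), and antitonicity in the
level finishes. Intended family (advice, not a hypothesis): the Conneryd–Ghannane–Pang sparse
bounded-degree graphs with `6 ≤ d ≤ 14` (non-3-colourable by first moment, below the spectral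
refutation threshold, cohomologically `Ω(n)`-consistent by the tree theorem, so the gfp is non-empty).

* `stub_coupledLevel_antitone` — the inline coupled level is antitone in `κ` (restrict the degree,
  truncate the ℤ-sections to contexts of size `≤ κ'`). Formal, M — candidate proof attached on the item.
* `stub_sosGfpSupport` — OPEN (XL): `∃ γ > 0`, for all large `n` a non-3-colourable graph on `n`
  vertices with a degree-`2⌊γn⌋` pseudoexpectation for its 3-colouring system (Booleanity,
  `∑_c x_{v,c} = 1`, edge identities) that is POSITIVE EXACTLY on the gfp-`⌊γn⌋` sections (this forces
  cohomological `⌊γn⌋`-consistency of the graph: `E 1 = 1 > 0` puts the empty section in the gfp).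
  A linear-degree SOS lower bound for 3-colouring with max-entropy-type (full local) support on a
  family the ℤ-part does not reject — e.g. SPARSE graphs, no XOR structure.
* `stub_gfpSupport_coupled` — PROVABLE (M/L, format bridge): for ANY graph and any `E` with the SOS
  identities at `κ` whose positive `≤ κ`-sections are exactly the gfp-`κ` sections, the inline coupled
  level of crux B holds at `κ` (ℤ-extendability inside the positive support = `ZExt` inside the gfp,
  by `SectionSystem.gfp_isSelfSupporting`, transported from `Finsupp` on `↥U → Fin 3` to the inline
  `(Finset (Fin n) → (Fin n → Fin 3) → ℤ)` format with sections normalised to `0` off their context).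
* `JointSublinearFooling_of : Registered.stub_coupledLevel_antitone → Registered.stub_sosGfpSupport →
  Registered.stub_gfpSupport_coupled → JointSublinearFooling` — kernel-checked composition (eventually
  `k n ≤ ⌊γ n⌋`, then antitone); the `Registered.stub_*` abbrevs key the stub STATEMENTS by the stub names
  (device of `Cruxes/Capture/Lines/csp-spine-meet-to-join.lean`) for the native skeleton audit.
-/

set_option linter.dupNamespace false

noncomputable section

open scoped Classical
open Filter Literature.ModelTheory.FiniteModelTheory

namespace Summit.PneNP.PneNP.Cruxes.JointSublinearFooling.SparseSupport

/-! ## The three stub statements -/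

/-- Statement of STUB 1 (formal, M): the inline coupled level is antitone in the level parameter. -/
def CoupledLevelAntitone : Prop :=
  ∀ (n κ κ' : ℕ) (G : SimpleGraph (Fin n)), κ' ≤ κ → (∃ E : MvPolynomial ℕ ℝ →ₗ[ℝ] ℝ, Literature.Computability.MetaComplexity.IsPseudoexpectation (2 * κ) E ∧ (∀ i : ℕ, Literature.Computability.MetaComplexity.SatisfiesIdentity (2 * κ) E (Literature.Computability.MetaComplexity.boolAxiom i)) ∧ (∀ v : Fin n, Literature.Computability.MetaComplexity.SatisfiesIdentity (2 * κ) E (1 - ∑ c : Fin 3, MvPolynomial.X (3 * v.val + c.val))) ∧ (∀ u v : Fin n, G.Adj u v → ∀ c : Fin 3, Literature.Computability.MetaComplexity.SatisfiesIdentity (2 * κ) E (MvPolynomial.X (3 * u.val + c.val) * MvPolynomial.X (3 * v.val + c.val))) ∧ ∀ p : Finset (Fin n) × (Fin n → Fin 3), p.1.card ≤ κ → (∀ v, v ∉ p.1 → p.2 v = 0) → 0 < E (∏ v ∈ p.1, MvPolynomial.X (3 * v.val + (p.2 v).val)) → ∃ r : Finset (Fin n) → (Fin n → Fin 3) → ℤ,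 (∀ U t, r U t ≠ 0 → U.card ≤ κ ∧ (∀ v, v ∉ U → t v = 0) ∧ 0 < E (∏ v ∈ U, MvPolynomial.X (3 * v.val + (t v).val))) ∧ (∀ U D : Finset (Fin n), D ⊆ U → U.card ≤ κ → ∀ t' : Fin n → Fin 3, r D t' = ∑ t : Fin n → Fin 3, if (∀ v, t' v = if v ∈ D then t v else 0) then r U t else 0) ∧ r p.1 p.2 = 1 ∧ ∀ t, t ≠ p.2 → r p.1 t = 0) → (∃ E : MvPolynomial ℕ ℝ →ₗ[ℝ] ℝ, Literature.Computability.MetaComplexity.IsPseudoexpectation (2 * κ') E ∧ (∀ i : ℕ, Literature.Computability.MetaComplexity.SatisfiesIdentity (2 * κ') E (Literature.Computability.MetaComplexity.boolAxiom i)) ∧ (∀ v : Fin n, Literature.Computability.MetaComplexity.SatisfiesIdentity (2 * κ') E (1 - ∑ c : Fin 3, MvPolynomial.X (3 * v.val + c.val))) ∧ (∀ u v : Fin n, G.Adj u v → ∀ c : Fin 3, Literature.Computability.MetaComplexity.SatisfiesIdentity (2 * κ') E (MvPolynomial.X (3 * u.val + c.val) * MvPolynomial.X (3 * v.val + c.val)))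 ∧ ∀ p : Finset (Fin n) × (Fin n → Fin 3), p.1.card ≤ κ' → (∀ v, v ∉ p.1 → p.2 v = 0) → 0 < E (∏ v ∈ p.1, MvPolynomial.X (3 * v.val + (p.2 v).val)) → ∃ r : Finset (Fin n) → (Fin n → Fin 3) → ℤ, (∀ U t, r U t ≠ 0 → U.card ≤ κ' ∧ (∀ v, v ∉ U → t v = 0) ∧ 0 < E (∏ v ∈ U, MvPolynomial.X (3 * v.val + (t v).val))) ∧ (∀ U D : Finset (Fin n), D ⊆ U → U.card ≤ κ' → ∀ t' : Fin n → Fin 3, r D t' = ∑ t : Fin n → Fin 3, if (∀ v, t' v = if v ∈ D then t v else 0) then r U t else 0) ∧ r p.1 p.2 = 1 ∧ ∀ t, t ≠ p.2 → r p.1 t = 0)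

/-- Statement of STUB 2 (OPEN, XL — the heart of crux B): non-3-colourable graphs with a linear-degree
pseudoexpectation whose positive `≤ κ`-sections are exactly the gfp (cohomological `κ`-consistency)
sections. -/
def SosGfpSupport : Prop :=
  ∃ γ : ℝ, 0 < γ ∧ ∀ᶠ n : ℕ in Filter.atTop, ∃ G : SimpleGraph (Fin n), ¬ G.Colorable 3 ∧ ∃ E : MvPolynomial ℕ ℝ →ₗ[ℝ] ℝ, (Literature.Computability.MetaComplexity.IsPseudoexpectation (2 * ⌊γ * n⌋₊) E ∧ (∀ i : ℕ, Literature.Computability.MetaComplexity.SatisfiesIdentity (2 * ⌊γ * n⌋₊) E (Literature.Computability.MetaComplexity.boolAxiom i)) ∧ (∀ v : Fin n, Literature.Computability.MetaComplexity.SatisfiesIdentity (2 * ⌊γ * n⌋₊) E (1 - ∑ c : Fin 3, MvPolynomial.X (3 * v.val + c.val))) ∧ (∀ u v : Fin n, G.Adj u v → ∀ c : Fin 3, Literature.Computability.MetaComplexity.SatisfiesIdentity (2 * ⌊γ * n⌋₊) E (MvPolynomial.X (3 * u.val + c.val) * MvPolynomial.X (3 * v.val + c.val)))) ∧ (∀ p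 : Finset (Fin n) × (Fin n → Fin 3), p.1.card ≤ ⌊γ * n⌋₊ → (∀ v, v ∉ p.1 → p.2 v = 0) → (0 < E (∏ v ∈ p.1, MvPolynomial.X (3 * v.val + (p.2 v).val)) ↔ (fun v : ↥p.1 => p.2 v) ∈ SectionSystem.gfp ⌊γ * n⌋₊ (graphHomSystem ⌊γ * n⌋₊ G (⊤ : SimpleGraph (Fin 3))) p.1))

/-- Statement of STUB 3 (provable, format bridge): gfp-supported pseudoexpectations satisfy the inline
coupled level. -/
def GfpSupportCoupled : Prop :=
  ∀ (n κ : ℕ) (G : SimpleGraph (Fin n)) (E : MvPolynomial ℕ ℝ →ₗ[ℝ] ℝ), (Literature.Computability.MetaComplexity.IsPseudoexpectation (2 * κ) E ∧ (∀ i : ℕ, Literature.Computability.MetaComplexity.SatisfiesIdentity (2 * κ) E (Literature.Computability.MetaComplexity.boolAxiom i)) ∧ (∀ v : Fin n, Literature.Computability.MetaComplexity.SatisfiesIdentity (2 * κ) E (1 - ∑ c : Fin 3, MvPolynomial.X (3 * v.val + c.val))) ∧ (∀ u v : Fin n, G.Adj u v → ∀ c : Fin 3, Literature.Computability.MetaComplexity.SatisfiesIdentity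 (2 * κ) E (MvPolynomial.X (3 * u.val + c.val) * MvPolynomial.X (3 * v.val + c.val)))) → (∀ p : Finset (Fin n) × (Fin n → Fin 3), p.1.card ≤ κ → (∀ v, v ∉ p.1 → p.2 v = 0) → (0 < E (∏ v ∈ p.1, MvPolynomial.X (3 * v.val + (p.2 v).val)) ↔ (fun v : ↥p.1 => p.2 v) ∈ SectionSystem.gfp κ (graphHomSystem κ G (⊤ : SimpleGraph (Fin 3))) p.1)) → (Literature.Computability.MetaComplexity.IsPseudoexpectation (2 * κ) E ∧ (∀ i : ℕ, Literature.Computability.MetaComplexity.SatisfiesIdentity (2 * κ) E (Literature.Computability.MetaComplexity.boolAxiom i)) ∧ (∀ v : Fin n, Literature.Computability.MetaComplexity.SatisfiesIdentity (2 * κ) E (1 - ∑ c : Fin 3, MvPolynomial.X (3 * v.val + c.val))) ∧ (∀ u v : Fin n, G.Adj u v → ∀ c : Fin 3, Literature.Computability.MetaComplexity.SatisfiesIdentity (2 * κ) E (MvPolynomial.X (3 * u.val + c.val) * MvPolynomial.X (3 * v.val + c.val))) ∧ ∀ p : Finset (Fin n) × (Fin n → Fin 3), p.1.card ≤ κ →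 (∀ v, v ∉ p.1 → p.2 v = 0) → 0 < E (∏ v ∈ p.1, MvPolynomial.X (3 * v.val + (p.2 v).val)) → ∃ r : Finset (Fin n) → (Fin n → Fin 3) → ℤ, (∀ U t, r U t ≠ 0 → U.card ≤ κ ∧ (∀ v, v ∉ U → t v = 0) ∧ 0 < E (∏ v ∈ U, MvPolynomial.X (3 * v.val + (t v).val))) ∧ (∀ U D : Finset (Fin n), D ⊆ U → U.card ≤ κ → ∀ t' : Fin n → Fin 3, r D t' = ∑ t : Fin n → Fin 3, if (∀ v, t' v = if v ∈ D then t v else 0) then r U t else 0) ∧ r p.1 p.2 = 1 ∧ ∀ t, t ≠ p.2 → r p.1 t = 0)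

/-! ## The stubs (the ONLY sorries of this file) -/

theorem stub_coupledLevel_antitone : CoupledLevelAntitone := by
  sorry

theorem stub_sosGfpSupport : SosGfpSupport := by
  sorry

theorem stub_gfpSupport_coupled : GfpSupportCoupled := by
  sorry

/-! ## Name-keyed aliases of the stub statements (hypotheses of the composition) -/
namespace Registered

/-- Alias of `CoupledLevelAntitone` keyed by the registered stub name. -/
abbrev stub_coupledLevel_antitone : Prop := CoupledLevelAntitone
/-- Alias of `SosGfpSupport` keyed by the registered stub name. -/
abbrev stub_sosGfpSupport : Prop := SosGfpSupport
/-- Alias of `GfpSupportCoupled` keyed by the registered stub name. -/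
abbrev stub_gfpSupport_coupled : Prop := GfpSupportCoupled

end Registered

/-- COMPOSITION (kernel-checked, no sorry): the three stubs give crux B `JointSublinearFooling` BY NAME. -/
theorem JointSublinearFooling_of (h₁ : Registered.stub_coupledLevel_antitone)
    (h₂ : Registered.stub_sosGfpSupport) (h₃ : Registered.stub_gfpSupport_coupled) :
    Summit.PneNP.PneNP.Theses.DescentTower.JointSublinearFooling := by
  unfold Registered.stub_coupledLevel_antitone CoupledLevelAntitone at h₁
  unfold Registered.stub_sosGfpSupport SosGfpSupport at h₂
  unfold Registered.stub_gfpSupport_coupled GfpSupportCoupled at h₃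
  intro k hk
  obtain ⟨γ, hγ, hev⟩ := h₂
  have hlt : ∀ᶠ n : ℕ in atTop, (k n : ℝ) / n < γ / 2 := hk.eventually_lt_const (half_pos hγ)
  have hbig : ∀ᶠ n : ℕ in atTop, (2 : ℝ) ≤ γ * n :=
    (tendsto_natCast_atTop_atTop.const_mul_atTop hγ).eventually_ge_atTop 2
  filter_upwards [hev, hlt, hbig, eventually_ge_atTop 1] with n hn hkn hcn hn1
  obtain ⟨G, hG, E, hsos, hsupp⟩ := hn
  refine ⟨G, hG, ?_⟩
  have hle : k n ≤ ⌊γ * n⌋₊ := by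
    have hnpos : (0 : ℝ) < n := by exact_mod_cast hn1
    rw [div_lt_iff₀ hnpos] at hkn
    apply Nat.le_floor
    linarith
  have hacc := h₃ n ⌊γ * n⌋₊ G E hsos hsupp
  exact h₁ n ⌊γ * n⌋₊ (k n) G hle ⟨E, hacc⟩

end Summit.PneNP.PneNP.Cruxes.JointSublinearFooling.SparseSupport

end
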